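import Summits.Schanuel.Schanuel.Theorems.RootDecomp1EAnchorToolkit

/-!
# RootDecomp1E — anchor calculus, part 2: REDUCED TOWERS and the TOWER FIELD 𝕋 ⊇ 𝕃

Port (census seat, prover role) of §§ «REDUCED TOWERS», «The TOWER FIELD» of lens-2's node «AnchorTower»
(`HOME/decomp-schanuel-lens-2/g6/AnchorTower.lean`, critic CLEARED 2026-08-30T07:30:30Z), serving the support item `OffAxisClosure`
(stmt-Schanuel-30101).  Chow's «general remark» (arXiv:math/9805045 §3): a reduced tower of length τ generates a field of transcendence
degree ≤ τ (`IsTower.trdeg_le`); towers EXTEND and MERGE; the numbers algebraic over some ℚ-independent reduced tower form a subfield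
𝕋 = `towerField` of ℂ (`mem_towerField_iff`) that is exp-closed, log-closed and relatively algebraically closed, whence 𝕃 ≤ 𝕋
(`closedFormField_le_towerField`) and the TOWER LEMMA `exists_tower_of_closedForm`: every finite closed-form family lies in the ℚ-span
of a ℚ-independent reduced tower.  This file defines nothing; 0 sorry.
-/

set_option linter.dupNamespace false

noncomputable section

namespace Summit.Schanuel.Schanuel.Theorems.RootDecomp1EAnchor

open Complex IntermediateField
open Literature.NumberTheory.Transcendental (exists_nsmul_mem_span_int mem_adjoin_of_mem_span_int
  trdeg_adjoin_le_of_le isAlgebraic_adjoin_over_algebraAdjoin)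
open Summit.Schanuel.Schanuel.Theses.RootDecomp1E (DefectOneSchanuel ClosedFormAtomSchanuel OffAxisClosure)

/-! ## Reduced towers: one step costs at most one transcendence degree; towers extend and merge -/

/-- The generators of `F_{(x,t)}` are algebraic over `ℚ(t, e^t, y)` when `{x, e^x} ⊆ {a, y}` with `a`
algebraic over `F_t`. -/
theorem gens_cons_isAlgebraic_insert {τ : ℕ} (t : Fin τ → ℂ) (x a y : ℂ)
    (ha : IsAlgebraic ↥(adjoin ℚ (Set.range t ∪ Set.range (cexp ∘ t))) a)
    (hx : x = a ∨ x = y) (hex : cexp x = a ∨ cexp x = y) :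
    ∀ v ∈ Set.range (Fin.cons x t : Fin (τ + 1) → ℂ) ∪ Set.range (cexp ∘ (Fin.cons x t : Fin (τ + 1) → ℂ)),
      IsAlgebraic ↥(adjoin ℚ (insert y (Set.range t ∪ Set.range (cexp ∘ t)))) v := by
  have hle : adjoin ℚ (Set.range t ∪ Set.range (cexp ∘ t)) ≤
      adjoin ℚ (insert y (Set.range t ∪ Set.range (cexp ∘ t))) := adjoin.mono ℚ _ _ (Set.subset_insert _ _)
  have hy : IsAlgebraic ↥(adjoin ℚ (insert y (Set.range t ∪ Set.range (cexp ∘ t)))) y :=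
    isAlgebraic_of_mem_adjoin (subset_adjoin ℚ _ (Set.mem_insert _ _))
  have ha' : IsAlgebraic ↥(adjoin ℚ (insert y (Set.range t ∪ Set.range (cexp ∘ t)))) a :=
    isAlgebraic_of_le hle ha
  rintro v (⟨i, rfl⟩ | ⟨i, rfl⟩)
  · refine Fin.cases ?_ (fun j => ?_) i
    · simp only [Fin.cons_zero]
      rcases hx with rfl | rfl
      · exact ha'
      · exact hy
    · simp only [Fin.cons_succ]
      exact isAlgebraic_of_mem_adjoin (subset_adjoin ℚ _ (Set.mem_insert_of_mem _ (Or.inl ⟨j, rfl⟩)))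
  · refine Fin.cases ?_ (fun j => ?_) i
    · simp only [Function.comp_apply, Fin.cons_zero]
      rcases hex with h | h <;> rw [h]
      · exact ha'
      · exact hy
    · simp only [Function.comp_apply, Fin.cons_succ]
      exact isAlgebraic_of_mem_adjoin (subset_adjoin ℚ _ (Set.mem_insert_of_mem _ (Or.inr ⟨j, rfl⟩)))

/-- One tower step raises the transcendence degree by at most one. -/
theorem trdeg_cons_le_succ {τ : ℕ} (t : Fin τ → ℂ) (x : ℂ)
    (hx : IsAlgebraic ↥(adjoin ℚ (Set.range t ∪ Set.range (cexp ∘ t))) x ∨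
      IsAlgebraic ↥(adjoin ℚ (Set.range t ∪ Set.range (cexp ∘ t))) (cexp x)) :
    Algebra.trdeg ℚ ↥(adjoin ℚ (Set.range (Fin.cons x t : Fin (τ + 1) → ℂ) ∪
        Set.range (cexp ∘ (Fin.cons x t : Fin (τ + 1) → ℂ)))) ≤
      Algebra.trdeg ℚ ↥(adjoin ℚ (Set.range t ∪ Set.range (cexp ∘ t))) + 1 := by
  -- the non-algebraic one of `x`, `e^x` is `y`; adjoin it first
  obtain ⟨a, y, ha, hxa, hexa⟩ : ∃ a y : ℂ, IsAlgebraic ↥(adjoin ℚ (Set.range t ∪ Set.range (cexp ∘ t))) a ∧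
      (x = a ∨ x = y) ∧ (cexp x = a ∨ cexp x = y) := by
    rcases hx with h | h
    · exact ⟨x, cexp x, h, Or.inl rfl, Or.inr rfl⟩
    · exact ⟨cexp x, x, h, Or.inr rfl, Or.inl rfl⟩
  have h1 := trdeg_adjoin_le_of_isAlgebraic (gens_cons_isAlgebraic_insert t x a y ha hxa hexa)
  refine h1.trans ?_
  have h2 : insert y (Set.range t ∪ Set.range (cexp ∘ t)) = (Set.range t ∪ Set.range (cexp ∘ t)) ∪ {y} := by
    rw [Set.union_singleton]
  rw [h2]
  refine (trdeg_adjoin_union_le _ _).trans ?_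
  have hy1 : Algebra.trdeg ℚ ↥(adjoin ℚ ({y} : Set ℂ)) ≤ 1 := by
    exact_mod_cast trdeg_adjoin_le_nat (F := ℚ) ({y} : Set ℂ) (n := 1) (by simp)
  exact (add_le_add hy1 le_rfl).trans_eq (add_comm _ _)

/-- **Chow's «general remark» (1999, p. 4): a reduced tower of length τ generates a field of transcendence
degree at most τ.**  [arXiv:math/9805045 §3] -/
theorem IsTower.trdeg_le {τ : ℕ} {t : Fin τ → ℂ} (ht : IsTower τ t) :
    Algebra.trdeg ℚ ↥(adjoin ℚ (Set.range t ∪ Set.range (cexp ∘ t))) ≤ (τ : Cardinal) := by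
  induction ht with
  | zero t =>
    have he : Set.range t ∪ Set.range (cexp ∘ t) = ∅ := by
      simp [Set.range_eq_empty]
    refine trdeg_adjoin_le_nat (F := ℚ) _ ?_
    rw [he]
    simp
  | cons t x ht hx ih =>
    refine (trdeg_cons_le_succ t x hx).trans ?_
    push_cast
    gcongr

/-- Every member of a reduced tower is a closed-form number. -/
theorem IsTower.mem_closedFormField {τ : ℕ} {t : Fin τ → ℂ} (ht : IsTower τ t) :
    ∀ k, t k ∈ closedFormField := by
  induction ht with
  | zero t => exact fun k => k.elim0
  | cons t x ht hx ih =>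
    have hle : adjoin ℚ (Set.range t ∪ Set.range (cexp ∘ t)) ≤ closedFormField :=
      adjoin_le_closedFormField ih
    have hxL : x ∈ closedFormField := hx.elim
      (fun h => mem_closedFormField_of_isAlgebraic_closedFormField (isAlgebraic_of_le hle h))
      (fun h => mem_closedFormField_of_exp_mem
        (mem_closedFormField_of_isAlgebraic_closedFormField (isAlgebraic_of_le hle h)))
    intro k
    refine Fin.cases ?_ (fun j => ?_) k
    · simpa using hxL
    · simpa using ih j

/-- The ℚ-span of a reduced tower lies in 𝕃. -/
theorem IsTower.span_le_closedFormField {τ : ℕ} {t : Fin τ → ℂ} (ht : IsTower τ t) {x : ℂ}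
    (hx : x ∈ Submodule.span ℚ (Set.range t)) : x ∈ closedFormField :=
  mem_closedFormField_of_mem_span ht.mem_closedFormField hx

/-- EXTENSION: a number `x` with `x` or `e^x` algebraic over `F_t` lies in the span of a (possibly longer)
ℚ-independent reduced tower extending `t`. -/
theorem IsTower.extend {τ : ℕ} {t : Fin τ → ℂ} (ht : IsTower τ t) (hli : LinearIndependent ℚ t) {x : ℂ}
    (hx : IsAlgebraic ↥(adjoin ℚ (Set.range t ∪ Set.range (cexp ∘ t))) x ∨
      IsAlgebraic ↥(adjoin ℚ (Set.range t ∪ Set.range (cexp ∘ t))) (cexp x)) :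
    ∃ (τ' : ℕ) (t' : Fin τ' → ℂ), IsTower τ' t' ∧ LinearIndependent ℚ t' ∧
      x ∈ Submodule.span ℚ (Set.range t') ∧ ∀ k, t k ∈ Submodule.span ℚ (Set.range t') := by
  by_cases hxs : x ∈ Submodule.span ℚ (Set.range t)
  · exact ⟨τ, t, ht, hli, hxs, fun k => Submodule.subset_span ⟨k, rfl⟩⟩
  · refine ⟨τ + 1, Fin.cons x t, IsTower.cons t x ht hx, linearIndependent_finCons.mpr ⟨hli, hxs⟩,
      Submodule.subset_span ⟨0, by simp⟩, fun k => Submodule.subset_span ⟨k.succ, by simp⟩⟩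

/-- MERGE: two reduced towers (the first ℚ-independent) lie in the span of one ℚ-independent reduced tower. -/
theorem IsTower.merge {τ' : ℕ} {t' : Fin τ' → ℂ} (ht' : IsTower τ' t') :
    ∀ {τ : ℕ} {t : Fin τ → ℂ}, IsTower τ t → LinearIndependent ℚ t →
      ∃ (τ'' : ℕ) (t'' : Fin τ'' → ℂ), IsTower τ'' t'' ∧ LinearIndependent ℚ t'' ∧
        (∀ k, t k ∈ Submodule.span ℚ (Set.range t'')) ∧ ∀ k, t' k ∈ Submodule.span ℚ (Set.range t'') := by
  induction ht' with
  | zero t' =>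
    intro τ t ht hli
    exact ⟨τ, t, ht, hli, fun k => Submodule.subset_span ⟨k, rfl⟩, fun k => k.elim0⟩
  | cons t' x ht'₀ hx ih =>
    intro τ t ht hli
    obtain ⟨τ₁, t₁, ht₁, hli₁, hts, ht's⟩ := ih ht hli
    have hx₁ : IsAlgebraic ↥(adjoin ℚ (Set.range t₁ ∪ Set.range (cexp ∘ t₁))) x ∨
        IsAlgebraic ↥(adjoin ℚ (Set.range t₁ ∪ Set.range (cexp ∘ t₁))) (cexp x) :=
      hx.imp (isAlgebraic_transfer ht's) (isAlgebraic_transfer ht's)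
    obtain ⟨τ₂, t₂, ht₂, hli₂, hx₂, ht₁s⟩ := ht₁.extend hli₁ hx₁
    refine ⟨τ₂, t₂, ht₂, hli₂, fun k => span_range_le ht₁s (hts k), fun k => ?_⟩
    refine Fin.cases ?_ (fun j => ?_) k
    · simpa using hx₂
    · simpa using span_range_le ht₁s (ht's j)

/-! ## The TOWER FIELD 𝕋 ⊇ 𝕃: every closed-form number is algebraic over a reduced tower -/

/-- Algebraic numbers are tower-algebraic (over the empty tower). -/
theorem inTower_of_isAlgebraic {x : ℂ} (hx : IsAlgebraic ℚ x) : InTower x :=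
  ⟨0, Fin.elim0, IsTower.zero _, linearIndependent_empty_type, hx.tower_top (L := ↥(adjoin ℚ _))⟩

/-- Finitely many tower-algebraic numbers are algebraic over ONE ℚ-independent reduced tower. -/
theorem inTower_common {m : ℕ} (c : Fin m → ℂ) (hc : ∀ i, InTower (c i)) :
    ∃ (τ : ℕ) (t : Fin τ → ℂ), IsTower τ t ∧ LinearIndependent ℚ t ∧
      ∀ i, IsAlgebraic ↥(adjoin ℚ (Set.range t ∪ Set.range (cexp ∘ t))) (c i) := by
  induction m with
  | zero => exact ⟨0, Fin.elim0, IsTower.zero _, linearIndependent_empty_type, fun i => i.elim0⟩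
  | succ m ih =>
    obtain ⟨τ, t, ht, hli, halg⟩ := ih (fun i => c i.succ) (fun i => hc i.succ)
    obtain ⟨τ₀, t₀, ht₀, hli₀, h₀⟩ := hc 0
    obtain ⟨τ₁, t₁, ht₁, hli₁, hts, ht₀s⟩ := ht₀.merge ht hli
    refine ⟨τ₁, t₁, ht₁, hli₁, fun i => ?_⟩
    refine Fin.cases ?_ (fun j => ?_) i
    · exact isAlgebraic_transfer ht₀s h₀
    · exact isAlgebraic_transfer hts (halg j)

/-- Two tower-algebraic numbers are algebraic over ONE common ℚ-independent reduced tower. -/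
theorem inTower_pair {x y : ℂ} (hx : InTower x) (hy : InTower y) :
    ∃ (τ : ℕ) (t : Fin τ → ℂ), IsTower τ t ∧ LinearIndependent ℚ t ∧
      IsAlgebraic ↥(adjoin ℚ (Set.range t ∪ Set.range (cexp ∘ t))) x ∧
      IsAlgebraic ↥(adjoin ℚ (Set.range t ∪ Set.range (cexp ∘ t))) y := by
  obtain ⟨τ, t, ht, hli, h⟩ := inTower_common ![x, y] fun i => by
    refine Fin.cases ?_ (fun j => ?_) i
    · simpa using hx
    · have hj : j = 0 := Subsingleton.elim j 0
      subst hj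
      simpa using hy
  exact ⟨τ, t, ht, hli, by simpa using h 0, by simpa using h 1⟩

/-- `𝕋 = towerField` (the subfield GENERATED by the tower-algebraic numbers) consists exactly of the tower-algebraic numbers:
they already form a subfield (finitely many of them are algebraic over ONE common tower, `inTower_pair`). -/
theorem mem_towerField_iff {x : ℂ} : x ∈ towerField ↔ InTower x := by
  let T : IntermediateField ℚ ℂ :=
    { carrier := {x | InTower x}
      mul_mem' := by
        intro a b ha hb
        obtain ⟨τ, t, ht, hli, ha', hb'⟩ := inTower_pair ha hb
        exact ⟨τ, t, ht, hli, isAlgebraic_mul ha' hb'⟩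
      one_mem' := inTower_of_isAlgebraic isAlgebraic_one
      add_mem' := by
        intro a b ha hb
        obtain ⟨τ, t, ht, hli, ha', hb'⟩ := inTower_pair ha hb
        exact ⟨τ, t, ht, hli, mem_algebraicClosure_iff.mp
          (add_mem (mem_algebraicClosure_iff.mpr ha') (mem_algebraicClosure_iff.mpr hb'))⟩
      zero_mem' := inTower_of_isAlgebraic isAlgebraic_zero
      algebraMap_mem' := fun r => inTower_of_isAlgebraic (isAlgebraic_algebraMap r)
      inv_mem' := by
        intro a ha
        obtain ⟨τ, t, ht, hli, ha'⟩ := ha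
        exact ⟨τ, t, ht, hli, mem_algebraicClosure_iff.mp (inv_mem (mem_algebraicClosure_iff.mpr ha'))⟩ }
  have hle : towerField ≤ T := by
    rw [towerField, adjoin_le_iff]
    exact fun y hy => hy
  exact ⟨fun hx => hle hx, fun hx => subset_adjoin ℚ _ hx⟩

/-- 𝕋 is closed under `exp`. -/
theorem exp_mem_towerField {w : ℂ} (hw : w ∈ towerField) : cexp w ∈ towerField := by
  obtain ⟨τ, t, ht, hli, hw'⟩ := mem_towerField_iff.mp hw
  obtain ⟨τ', t', ht', hli', hws, _⟩ := ht.extend hli (Or.inl hw')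
  exact mem_towerField_iff.mpr ⟨τ', t', ht', hli', exp_isAlgebraic_of_mem_span hws⟩

/-- 𝕋 is closed under all logarithms. -/
theorem mem_towerField_of_exp_mem {w : ℂ} (hw : cexp w ∈ towerField) : w ∈ towerField := by
  obtain ⟨τ, t, ht, hli, hw'⟩ := mem_towerField_iff.mp hw
  obtain ⟨τ', t', ht', hli', hws, _⟩ := ht.extend hli (Or.inr hw')
  exact mem_towerField_iff.mpr ⟨τ', t', ht', hli', isAlgebraic_of_mem_adjoin (mem_adjoin_of_mem_span hws)⟩

/-- 𝕋 is relatively algebraically closed in ℂ (the coefficients of a polynomial over 𝕋 are finitely many,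
hence algebraic over one common tower). -/
theorem mem_towerField_of_isAlgebraic {w : ℂ} (hw : IsAlgebraic ↥towerField w) : w ∈ towerField := by
  classical
  obtain ⟨p, hp0, hpw⟩ := hw
  set P : Polynomial ℂ := p.map (algebraMap ↥towerField ℂ) with hP
  have hP0 : P ≠ 0 := (Polynomial.map_ne_zero_iff (algebraMap ↥towerField ℂ).injective).mpr hp0
  have hPw : P.eval w = 0 := by rw [hP, Polynomial.eval_map, ← Polynomial.aeval_def]; exact hpw
  have hcoeff : ∀ i, InTower (P.coeff i) := fun i => by
    rw [hP, Polynomial.coeff_map]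
    exact mem_towerField_iff.mp (SetLike.coe_mem _)
  -- one tower for all coefficients
  obtain ⟨τ, t, ht, hli, halg⟩ := inTower_common (fun i : Fin (P.natDegree + 1) => P.coeff i)
    (fun i => hcoeff i)
  set K : IntermediateField ℚ ℂ := adjoin ℚ (Set.range t ∪ Set.range (cexp ∘ t)) with hK
  set M : IntermediateField ↥K ℂ := algebraicClosure ↥K ℂ with hM
  have hmem : ∀ i : ℕ, P.coeff i ∈ M := by
    intro i
    by_cases hi : i < P.natDegree + 1
    · exact mem_algebraicClosure_iff.mpr (halg ⟨i, hi⟩)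
    · rw [Polynomial.coeff_eq_zero_of_natDegree_lt (by omega)]
      exact zero_mem M
  have hlift : P ∈ Polynomial.lifts (algebraMap ↥M ℂ) := by
    rw [Polynomial.lifts_iff_coeff_lifts]
    intro i
    exact ⟨⟨P.coeff i, hmem i⟩, rfl⟩
  obtain ⟨q, hq⟩ := (Polynomial.mem_lifts P).mp hlift
  have hq0 : q ≠ 0 := by
    rintro rfl
    rw [Polynomial.map_zero] at hq
    exact hP0 hq.symm
  have hwM : IsAlgebraic ↥M w :=
    ⟨q, hq0, by rw [Polynomial.aeval_def, ← Polynomial.eval_map, hq]; exact hPw⟩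
  haveI : Algebra.IsIntegral ↥K ↥M := Algebra.isAlgebraic_iff_isIntegral.mp inferInstance
  have hwK : IsAlgebraic ↥K w :=
    isAlgebraic_iff_isIntegral.mpr (isIntegral_trans (R := ↥K) (A := ↥M) w (isAlgebraic_iff_isIntegral.mp hwM))
  exact mem_towerField_iff.mpr ⟨τ, t, ht, hli, hwK⟩

/-- **𝕃 ≤ 𝕋**: the closed-form field is contained in the tower field (𝕋 is exp-closed, log-closed and
relatively algebraically closed; 𝕃 is the least such field). -/
theorem closedFormField_le_towerField : closedFormField ≤ towerField :=
  sInf_le ⟨fun _ hw => exp_mem_towerField hw, fun _ hw => mem_towerField_of_exp_mem hw,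
    fun _ hw => mem_towerField_of_isAlgebraic hw⟩

/-- **TOWER LEMMA.**  Every finite family of closed-form numbers lies in the ℚ-span of a ℚ-linearly
independent reduced tower (of closed-form numbers, generating a field of transcendence degree at most its
length).  [Chow 1999 §3; Lin 1983] -/
theorem exists_tower_of_closedForm {a : ℕ} (ℓ : Fin a → ℂ) (hℓ : ∀ j, ℓ j ∈ closedFormField) :
    ∃ (τ : ℕ) (t : Fin τ → ℂ), IsTower τ t ∧ LinearIndependent ℚ t ∧
      ∀ j, ℓ j ∈ Submodule.span ℚ (Set.range t) := by
  induction a with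
  | zero => exact ⟨0, Fin.elim0, IsTower.zero _, linearIndependent_empty_type, fun j => j.elim0⟩
  | succ a ih =>
    obtain ⟨τ, t, ht, hli, hs⟩ := ih (fun j => ℓ j.succ) (fun j => hℓ j.succ)
    obtain ⟨τ₀, t₀, ht₀, hli₀, h₀⟩ := mem_towerField_iff.mp (closedFormField_le_towerField (hℓ 0))
    obtain ⟨τ₁, t₁, ht₁, hli₁, hts, ht₀s⟩ := ht₀.merge ht hli
    obtain ⟨τ₂, t₂, ht₂, hli₂, hℓ0, ht₁s⟩ := ht₁.extend hli₁ (Or.inl (isAlgebraic_transfer ht₀s h₀))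
    refine ⟨τ₂, t₂, ht₂, hli₂, fun j => ?_⟩
    refine Fin.cases ?_ (fun i => ?_) j
    · exact hℓ0
    · exact span_range_le ht₁s (span_range_le hts (hs i))

/-! ## CLOSED-FORM SCHANUEL from S⁻ ∧ CF (a shortest closed-form counterexample is a closed-form atom) -/

/-- S⁻ saturates every failure of Schanuel. [gen-4 node] -/
theorem saturated_of_defectOne (hD : DefectOneSchanuel) {n : ℕ} {z : Fin n → ℂ}
    (hz : LinearIndependent ℚ z) (hlt : Algebra.trdeg ℚ ↥(adjoin ℚ (Set.range z ∪ Set.range (cexp ∘ z))) < (n : Cardinal)) : Saturated n z := by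
  intro v hv hev
  by_contra hvs
  have hli : LinearIndependent ℚ (Fin.cons v z : Fin (n + 1) → ℂ) :=
    linearIndependent_finCons.mpr ⟨hz, hvs⟩
  obtain ⟨s, hsn, hs⟩ := exists_nat_lt_of_lt_natCast hlt
  have h1 := hD (n + 1) _ hli
  have h2 := trdeg_adjoin_le_of_isAlgebraic (gens_cons_isAlgebraic _ z v le_rfl hv hev)
  have h3 : ((n + 1 : ℕ) : Cardinal) ≤ (s : Cardinal) + 1 :=
    h1.trans (add_le_add (h2.trans hs.le) le_rfl)
  have h4 : n + 1 ≤ s + 1 := by exact_mod_cast h3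
  omega

/-- **`S⁻ ∧ CF ⟹ CFS`**: a shortest closed-form counterexample is span-minimal (its shorter sub-tuples are
closed-form) and saturated (S⁻) — a closed-form atom. -/
theorem closedFormSchanuel_of (hD : DefectOneSchanuel) (hC : ClosedFormAtomSchanuel) : ClosedFormSchanuel := by
  intro n
  induction n using Nat.strong_induction_on with
  | _ n ih =>
    intro z hz hzL
    by_contra hlt
    rw [not_le] at hlt
    have hmin : SpanMinimal n z := fun m w hm hw hwz =>
      ih m hm w hw fun j => mem_closedFormField_of_mem_span hzL (hwz j)
    have hsat : Saturated n z := saturated_of_defectOne hD hz hlt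
    exact absurd (hC n z hz hzL hmin hsat) (not_le.mpr hlt)

end Summit.Schanuel.Schanuel.Theorems.RootDecomp1EAnchor
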